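import Summits.HubbardSuperconductivity.HubbardSuperconductivity.Theorems.WeakCouplingBCSWcbcsSsbToTorusLROReduction
import HarnessLib

/-!
# Crux `WcbcsSsbToTorusLRO` (stmt-HubbardSuperconductivity-2009), line `off-zero-mode-moment-closure` ⊕ `neutral-curvature-face-purity`:
# the POINTWISE composition (every `(U, δ, μ)`) and the `δ`-first (swapped) form

The landed reduction `wcbcsSsbToTorusLRO_of_stiffness_curvature_charging` (p91563) composes the three open physical inputs
of the line — (T) torus pair stiffness, (N) the neutral-curvature floor, (C) the charging floor — in their registered GUARDED forms
(`∃ U₀ ∀ U ∈ (0,U₀) ∀ δ ∀ μ, DM → Order → body`). Both halves it uses are already pointwise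
(`infraredLeak_of_stiffness_of_charging` at `(U, δ)`, `derivFacePurity_of_neutralCurvature` at `(U, δ, μ)`), so the composition
itself is pointwise; this file records that, for planners who want to file the children in any quantifier shape
(Disproof §4: the route's deciding theorem `closes` fixes `δ` before it uses this crux, so the `δ`-first form `∀ δ ∃ U₀(δ)` is free):

* `hasDWavePairFieldLROAt_of_stiffness_curvature_charging_at` — at every `(U, δ, μ)` with `0 < U`, `δ ∈ (0, 1/2)`:
  T-body `U δ` → N-body `U δ μ` → C-body `U δ` → density matching → `HasDWaveOrder U μ` → `HasDWavePairFieldLROAt U δ`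
  (the summit matrix at `(U, δ)`); item 9491 (canonical supporting potential) is discharged by the landed
  `CwSsbToEvenTorusLRO.stub_canonicalSupportingPotential` exactly as in p91563.
* `wcbcsSsbToTorusLRO_swapped_of_pointwise` — the `δ`-first guarded children give the `δ`-first crux (`CruxSwapped` of the
  Disproof), eight lines of quantifier bookkeeping over the pointwise theorem.

No definition and no named fact is introduced; the physics is entirely in the three hypotheses.
-/

noncomputable section

set_option linter.dupNamespace false

namespace Summit.HubbardSuperconductivity.HubbardSuperconductivity.Theorems.WcbcsSsbToTorusLRO

open Literature.MathematicalPhysics.QuantumLattice Literature.Probability.LatticeModels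
open Summit.HubbardSuperconductivity.WcbcsSsbToTorusLRO.Negative (floor_of_deriv_of_leak hasDWavePairFieldLROAt_of_floor)
open Matrix Filter Set
open scoped ComplexOrder ComplexConjugate

/-- **The pointwise composition.** At every `(U, δ, μ)` with `0 < U` and `δ ∈ (0, 1/2)`: torus pair stiffness (T-body at
`(U, δ)`), the neutral-curvature floor (N-body at `(U, δ, μ)`) and the charging floor (C-body at `(U, δ)`), together with
density matching and Koma–Tasaki `d`-wave order at `(U, μ)`, give the summit matrix `HasDWavePairFieldLROAt U δ`. Proof: the
landed halves `derivFacePurity_of_neutralCurvature` (with item 9491 discharged by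
`CwSsbToEvenTorusLRO.stub_canonicalSupportingPotential`) and `infraredLeak_of_stiffness_of_charging` feed the landed
dissection `Negative.floor_of_deriv_of_leak`, and `Negative.hasDWavePairFieldLROAt_of_floor` reads off the matrix. -/
theorem hasDWavePairFieldLROAt_of_stiffness_curvature_charging_at :
    ∀ (U δ μ : ℝ), 0 < U → δ ∈ Set.Ioo (0:ℝ) (1 / 2) → (∃ C η : ℝ, 0 < η ∧ ∀ᶠ k : ℕ in Filter.atTop, ∀ ψ : Fock (Orb (FermionTorus 2 (2 * k + 1 + 1))), IsGroundStateInSector (hubbardTorus 2 (2 * k + 1 + 1) 1 U) (2 * ⌊(1 - δ) * ((2 * k + 1 + 1 : ℕ) : ℝ) ^ 2 / 2⌋₊) 0 ψ → star ψ ⬝ᵥ ψ = 1 → ∀ m : TorusSite 2 (2 * k + 1 + 1), m ≠ 0 → momentumNormSq (2 * k + 1 + 1) m < η ^ 2 → (∀ w : Fock (Orb (FermionTorus 2 (2 * k + 1 + 1))), w ∈ szSector (Λ := FermionTorus 2 (2 * k + 1 + 1)) (2 * ⌊(1 - δ) * ((2 * k + 1 + 1 : ℕ) : ℝ) ^ 2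 / 2⌋₊ - 2) 0 → 2 * (star w ⬝ᵥ (pairFieldAt dWaveFormFactor (2 * k + 1 + 1) m *ᵥ ψ)).re - ((star w ⬝ᵥ (hubbardTorus 2 (2 * k + 1 + 1) 1 U *ᵥ w)).re - (hubbardTorus 2 (2 * k + 1 + 1) 1 U).minEnergyOn (szSector (2 * ⌊(1 - δ) * ((2 * k + 1 + 1 : ℕ) : ℝ) ^ 2 / 2⌋₊ - 2) 0) * (star w ⬝ᵥ w).re) ≤ C * ((2 * k + 1 + 1 : ℕ) : ℝ) ^ 2 / momentumNormSq (2 * k + 1 + 1) m) ∧ (∀ w : Fock (Orb (FermionTorus 2 (2 * k + 1 + 1))), w ∈ szSector (Λ := FermionTorus 2 (2 * k + 1 + 1)) (2 * ⌊(1 - δ) * ((2 * k + 1 + 1 : ℕ) : ℝ) ^ 2 / 2⌋₊ + 2) 0 → 2 * (star w ⬝ᵥ ((pairFieldAt dWaveFormFactor (2 * k + 1 + 1) m)ᴴ *ᵥ ψ)).re - ((star w ⬝ᵥ (hubbardTorus 2 (2 * k + 1 + 1) 1 U *ᵥ w)).re - (hubbardTorus 2 (2 * k + 1 + 1) 1 U).minEnergyOn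 (szSector (2 * ⌊(1 - δ) * ((2 * k + 1 + 1 : ℕ) : ℝ) ^ 2 / 2⌋₊ + 2) 0) * (star w ⬝ᵥ w).re) ≤ C * ((2 * k + 1 + 1 : ℕ) : ℝ) ^ 2 / momentumNormSq (2 * k + 1 + 1) m)) → (∀ R : ℕ, 0 < R → ∃ C : ℝ, 0 ≤ C ∧ ∃ κ₀ : ℝ, 0 < κ₀ ∧ ∃ h₀ : ℝ, 0 < h₀ ∧ ∀ κ ∈ Set.Ioo (0:ℝ) κ₀, ∀ h ∈ Set.Ioo (0:ℝ) h₀, ∀ᶠ L : ℕ in Filter.atTop, -C * κ ^ 2 * ((L + 1 : ℕ) : ℝ) ^ 2 ≤ (dWaveSourceTorus (L + 1) U μ h + (κ : ℂ) • (((((R : ℝ) ^ 4)⁻¹ : ℝ) : ℂ) • ∑ a : Literature.Probability.LatticeModels.TorusSite 2 (L + 1), (∑ u : Fin 2 → Fin R, localPair dWaveFormFactor (L + 1) (a + fun i => ((u i : ℕ) : ZMod (L + 1))))ᴴ * (∑ u : Fin 2 → Fin R, localPair dWaveFormFactor (L + 1) (a + fun i => ((u i : ℕ) : ZMod (L + 1)))))).groundEnergy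 + (dWaveSourceTorus (L + 1) U μ h + ((-κ : ℝ) : ℂ) • (((((R : ℝ) ^ 4)⁻¹ : ℝ) : ℂ) • ∑ a : Literature.Probability.LatticeModels.TorusSite 2 (L + 1), (∑ u : Fin 2 → Fin R, localPair dWaveFormFactor (L + 1) (a + fun i => ((u i : ℕ) : ZMod (L + 1))))ᴴ * (∑ u : Fin 2 → Fin R, localPair dWaveFormFactor (L + 1) (a + fun i => ((u i : ℕ) : ZMod (L + 1)))))).groundEnergy - 2 * (dWaveSourceTorus (L + 1) U μ h).groundEnergy) → (∀ ε : ℝ, 0 < ε → ∀ᶠ k : ℕ in Filter.atTop, -ε ≤ (1 + Real.log ((2 * k + 1 + 1 : ℕ) : ℝ)) * pairGap (hubbardTorus 2 (2 * k + 1 + 1) 1 U) (2 * ⌊(1 - δ) * ((2 * k + 1 + 1 : ℕ) : ℝ) ^ 2 / 2⌋₊)) → Filter.Tendsto (fun L : ℕ => ((hubbardTorusWith 2 (L + 1) 1 U μ).groundStateFunctional totalNumber).re / ((L + 1 : ℕ) : ℝ) ^ 2) Filter.atTop (nhds (1 - δ)) → HasDWaveOrder U μ → Literature.Barriers.HubbardSuperconductivity.HasDWavePairFieldLROAt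 U δ := by
  intro U δ μ hU hδ hT hN hC hdm hord
  have hP := derivFacePurity_of_neutralCurvature U δ μ hδ hN
    (CwSsbToEvenTorusLRO.stub_canonicalSupportingPotential U δ ⟨hδ.1, by linarith [hδ.2]⟩) hdm hord
  have hIR := infraredLeak_of_stiffness_of_charging U δ hU hδ hT hC
  exact hasDWavePairFieldLROAt_of_floor (floor_of_deriv_of_leak hP hIR)

/-- **The `δ`-first (swapped) crux from `δ`-first guarded children.** If for every `δ ∈ (0, 1/2)` there is a window
`U₀(δ) > 0` on which, at every density-matched and ordered `(U, μ)`, the three bodies (T), (N), (C) hold, then for every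
`δ ∈ (0, 1/2)` there is `U₀(δ) > 0` such that `DM → HasDWaveOrder U μ → HasDWavePairFieldLROAt U δ` on that window — the
`CruxSwapped` form of Disproof §4, which still closes the route with crux 4 unchanged. Quantifier bookkeeping over
`hasDWavePairFieldLROAt_of_stiffness_curvature_charging_at`. -/
theorem wcbcsSsbToTorusLRO_swapped_of_pointwise :
    (∀ δ ∈ Set.Ioo (0:ℝ) (1 / 2), ∃ U₀ : ℝ, 0 < U₀ ∧ ∀ U ∈ Set.Ioo (0:ℝ) U₀, ∀ μ : ℝ, Filter.Tendsto (fun L : ℕ => ((hubbardTorusWith 2 (L + 1) 1 U μ).groundStateFunctional totalNumber).re / ((L + 1 : ℕ) : ℝ) ^ 2) Filter.atTop (nhds (1 - δ)) → HasDWaveOrder U μ → (∃ C η : ℝ, 0 < η ∧ ∀ᶠ k : ℕ in Filter.atTop, ∀ ψ : Fock (Orb (FermionTorus 2 (2 * k + 1 + 1))), IsGroundStateInSector (hubbardTorus 2 (2 * k + 1 + 1) 1 U) (2 * ⌊(1 - δ) * ((2 * k + 1 + 1 : ℕ) : ℝ) ^ 2 / 2⌋₊) 0 ψ → star ψ ⬝ᵥ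 ψ = 1 → ∀ m : TorusSite 2 (2 * k + 1 + 1), m ≠ 0 → momentumNormSq (2 * k + 1 + 1) m < η ^ 2 → (∀ w : Fock (Orb (FermionTorus 2 (2 * k + 1 + 1))), w ∈ szSector (Λ := FermionTorus 2 (2 * k + 1 + 1)) (2 * ⌊(1 - δ) * ((2 * k + 1 + 1 : ℕ) : ℝ) ^ 2 / 2⌋₊ - 2) 0 → 2 * (star w ⬝ᵥ (pairFieldAt dWaveFormFactor (2 * k + 1 + 1) m *ᵥ ψ)).re - ((star w ⬝ᵥ (hubbardTorus 2 (2 * k + 1 + 1) 1 U *ᵥ w)).re - (hubbardTorus 2 (2 * k + 1 + 1) 1 U).minEnergyOn (szSector (2 * ⌊(1 - δ) * ((2 * k + 1 + 1 : ℕ) : ℝ) ^ 2 / 2⌋₊ - 2) 0) * (star w ⬝ᵥ w).re) ≤ C * ((2 * k + 1 + 1 : ℕ) : ℝ) ^ 2 / momentumNormSq (2 * k + 1 + 1) m) ∧ (∀ w : Fock (Orb (FermionTorus 2 (2 * k + 1 + 1))), w ∈ szSector (Λ := FermionTorus 2 (2 * k + 1 + 1)) (2 * ⌊(1 - δ) *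 ((2 * k + 1 + 1 : ℕ) : ℝ) ^ 2 / 2⌋₊ + 2) 0 → 2 * (star w ⬝ᵥ ((pairFieldAt dWaveFormFactor (2 * k + 1 + 1) m)ᴴ *ᵥ ψ)).re - ((star w ⬝ᵥ (hubbardTorus 2 (2 * k + 1 + 1) 1 U *ᵥ w)).re - (hubbardTorus 2 (2 * k + 1 + 1) 1 U).minEnergyOn (szSector (2 * ⌊(1 - δ) * ((2 * k + 1 + 1 : ℕ) : ℝ) ^ 2 / 2⌋₊ + 2) 0) * (star w ⬝ᵥ w).re) ≤ C * ((2 * k + 1 + 1 : ℕ) : ℝ) ^ 2 / momentumNormSq (2 * k + 1 + 1) m)) ∧ (∀ R : ℕ, 0 < R → ∃ C : ℝ, 0 ≤ C ∧ ∃ κ₀ : ℝ, 0 < κ₀ ∧ ∃ h₀ : ℝ, 0 < h₀ ∧ ∀ κ ∈ Set.Ioo (0:ℝ) κ₀, ∀ h ∈ Set.Ioo (0:ℝ) h₀, ∀ᶠ L : ℕ in Filter.atTop, -C * κ ^ 2 * ((L + 1 : ℕ) : ℝ) ^ 2 ≤ (dWaveSourceTorus (L + 1) U μ h + (κ : ℂ)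 • (((((R : ℝ) ^ 4)⁻¹ : ℝ) : ℂ) • ∑ a : Literature.Probability.LatticeModels.TorusSite 2 (L + 1), (∑ u : Fin 2 → Fin R, localPair dWaveFormFactor (L + 1) (a + fun i => ((u i : ℕ) : ZMod (L + 1))))ᴴ * (∑ u : Fin 2 → Fin R, localPair dWaveFormFactor (L + 1) (a + fun i => ((u i : ℕ) : ZMod (L + 1)))))).groundEnergy + (dWaveSourceTorus (L + 1) U μ h + ((-κ : ℝ) : ℂ) • (((((R : ℝ) ^ 4)⁻¹ : ℝ) : ℂ) • ∑ a : Literature.Probability.LatticeModels.TorusSite 2 (L + 1), (∑ u : Fin 2 → Fin R, localPair dWaveFormFactor (L + 1) (a + fun i => ((u i : ℕ) : ZMod (L + 1))))ᴴ * (∑ u : Fin 2 → Fin R, localPair dWaveFormFactor (L + 1) (a + fun i => ((u i : ℕ) : ZMod (L + 1)))))).groundEnergy - 2 * (dWaveSourceTorus (L + 1) U μ h).groundEnergy) ∧ (∀ ε : ℝ, 0 < ε → ∀ᶠ k : ℕ in Filter.atTop, -ε ≤ (1 + Real.log ((2 * k + 1 + 1 : ℕ) : ℝ)) * pairGap (hubbardTorus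 2 (2 * k + 1 + 1) 1 U) (2 * ⌊(1 - δ) * ((2 * k + 1 + 1 : ℕ) : ℝ) ^ 2 / 2⌋₊))) → ∀ δ ∈ Set.Ioo (0:ℝ) (1 / 2), ∃ U₀ : ℝ, 0 < U₀ ∧ ∀ U ∈ Set.Ioo (0:ℝ) U₀, ∀ μ : ℝ, Filter.Tendsto (fun L : ℕ => ((hubbardTorusWith 2 (L + 1) 1 U μ).groundStateFunctional totalNumber).re / ((L + 1 : ℕ) : ℝ) ^ 2) Filter.atTop (nhds (1 - δ)) → HasDWaveOrder U μ → Literature.Barriers.HubbardSuperconductivity.HasDWavePairFieldLROAt U δ := by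
  intro h δ hδ
  obtain ⟨U₀, hU₀, h⟩ := h δ hδ
  refine ⟨U₀, hU₀, fun U hU μ hdm hord => ?_⟩
  obtain ⟨hT, hN, hC⟩ := h U hU μ hdm hord
  exact hasDWavePairFieldLROAt_of_stiffness_curvature_charging_at U δ μ hU.1 hδ hT hN hC hdm hord

end Summit.HubbardSuperconductivity.HubbardSuperconductivity.Theorems.WcbcsSsbToTorusLRO

end
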